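import Summits.ValiantsHypothesis.ValiantsHypothesis.Theorems.SymPencilSingFiveLeafCrossArmFive

/-!
# Route `SymPencil` — R11 `(11, 5, 5)` at `m ≤ 28`: LEAF X AT FIVE SQUARES, part 2 (the cross leaf)
# (`--supports` stmt-ValiantsHypothesis-5674 `SdcSuperquadratic`; rung currency only — nothing here bears on `VP ≠ VNP`)

Continuation of `SymPencilSingFiveLeafCrossArmFive` (same re-cut rule, same source: val-port-3 g4's copy-compile
`pub/val-lit/lmr/staged/port3g4-r11/R11F-copycompile.lean` 683855380e46eebf, texts VERBATIM, suffix `_five`; the unchanged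
`exists_span_of_support` cited by name from ✓ `SymPencilSingFiveLeafCrossArm`):

* `exists_rowArm_vanish_five`, `exists_colArm_vanish_five`, `crossFive33_five`, `crossFive_five` — leaf X with `Fin 5` square families: a `5`-dimensional
  `W ⊆ X_{lc}` with a per-direction family of `≤ 5` squares at every element is `X_{lc} ∩ {x_(l,a) = 0} ∩ {x_(b,c) = 0}` (`a ≠ c`, `b ≠ l`).

Consumers: port-3 g4's zero-row bridge / dispatch and the R11 cell file at `m ≤ 28` (OPTION B of record), or the OPTION-A copies — either
way cited by name.  Honest framing: [folklore] a re-typed copy; R11 OPEN; table 3/6; `28 ≤ sdc(per₄) ≤ 29` unchanged («= 29» forbidden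
until 6/6); `SdcSuperquadratic`, 5674 and `VP ≠ VNP` untouched; no summit statement is proved here.  No definitions, no named facts.
-/

noncomputable section

-- single-conjunct layout: Sub = Summit, duplicated namespace component intended
set_option linter.dupNamespace false

namespace Summit.ValiantsHypothesis.ValiantsHypothesis.Theorems.SymPencilSingFiveClassification

open MvPolynomial Module Matrix
open scoped Polynomial
open Literature.Computability.AlgebraicComplexity
open Summit.ValiantsHypothesis.ValiantsHypothesis.Theorems
open Summit.ValiantsHypothesis.ValiantsHypothesis.Theorems.SymPencilSingSixClassification
open Summit.ValiantsHypothesis.ValiantsHypothesis.Theorems.SymPencilPerFourJointFamilyTransport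

variable {K : Type*} [Field K]

/-- **A row-arm coordinate vanishes** on a `5`-dimensional `W ⊆ X₃₃` with `PerDirFive` (R11 copy at five of
✓ `exists_rowArm_vanish`): otherwise prime avoidance for the products `a₀a₁a₂ · b_i` puts `W` inside the 4-dimensional row arm. [folklore] -/
theorem exists_rowArm_vanish_five [CharZero K] (W : Submodule K (Fin 4 × Fin 4 → K))
    (hX : ∀ x ∈ W, ∀ i j : Fin 4, i ≠ 3 → j ≠ 3 → x (i, j) = 0) (h5 : finrank K W = 5)
    (hW : ∀ y ∈ W, ∃ (c : Fin 5 → K) (Λ : Fin 5 → ((Fin 4 × Fin 4 → K) →ₗ[K] K)),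
      ∀ u : Fin 4 × Fin 4 → K, ∃ e₀ e₁ : K, ∀ s : K,
        eval (u + s • y) (perPoly (Fin 4) K) = e₀ + s * e₁ + s ^ 2 * ∑ k, c k * (Λ k u) ^ 2) :
    ∃ a : Fin 4, a ≠ 3 ∧ ∀ y ∈ W, y (3, a) = 0 := by
  classical
  by_contra hnot
  push Not at hnot
  have hb : ∀ i : Fin 4, i ≠ 3 → ∀ y ∈ W, y (i, 3) = 0 := by
    intro i hi
    let f : Fin 4 → ((Fin 4 × Fin 4 → K) →ₗ[K] K) := fun t =>
      if t = 3 then LinearMap.proj ((i, 3) : Fin 4 × Fin 4)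
      else LinearMap.proj (((3 : Fin 4), t) : Fin 4 × Fin 4)
    have hf3 : ∀ y : Fin 4 × Fin 4 → K, f 3 y = y (i, 3) := fun y => by simp [f]
    have hft : ∀ t, t ≠ 3 → ∀ y : Fin 4 × Fin 4 → K, f t y = y (3, t) := fun t ht y => by
      simp [f, ht]
    have hprod : ∀ y ∈ W, ∏ t ∈ (Finset.univ : Finset (Fin 4)), f t y = 0 := by
      intro y hy
      obtain ⟨c, Λ, hfam⟩ := hW y hy
      rw [Fin.prod_univ_four, hft 0 (by decide), hft 1 (by decide), hft 2 (by decide), hf3]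
      by_cases ha : y (3, 0) * y (3, 1) * y (3, 2) = 0
      · rw [ha, zero_mul]
      · have hcol := colArm_eq_zero_of_sum_sq_five y (hX y hy) c Λ hfam ha
        have hi0 : y (i, 3) = 0 := by
          rcases (by decide : ∀ i : Fin 4, i ≠ 3 → i = 0 ∨ i = 1 ∨ i = 2) i hi with
            rfl | rfl | rfl
          · exact hcol.1
          · exact hcol.2.1
          · exact hcol.2.2
        rw [hi0, mul_zero]
    obtain ⟨t, -, ht⟩ :=
      SymPencilPerFourPairingHyperplane.exists_forall_eq_zero_of_prod_eq_zero W f Finset.univ hprod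
    by_cases ht3 : t = 3
    · subst ht3
      intro y hy
      rw [← hf3 y]
      exact ht y hy
    · obtain ⟨y, hy, hne⟩ := hnot t ht3
      exact (hne ((hft t ht3 y).symm.trans (ht y hy))).elim
  obtain ⟨C, hC, hCmem⟩ := exists_span_of_support (K := K)
    (Finset.univ.filter fun p : Fin 4 × Fin 4 => p.1 = 3)
  have hcard : (Finset.univ.filter fun p : Fin 4 × Fin 4 => p.1 = 3).card = 4 := by decide
  have hWC : W ≤ C := fun y hy => hCmem y fun p hp => by
    have hp1 : p.1 ≠ 3 := fun h => hp (Finset.mem_filter.2 ⟨Finset.mem_univ _, h⟩)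
    by_cases hp2 : p.2 = 3
    · have h := hb p.1 hp1 y hy
      rw [← hp2, Prod.mk.eta] at h
      exact h
    · have h := hX y hy p.1 p.2 hp1 hp2
      rwa [Prod.mk.eta] at h
  have hle := Submodule.finrank_mono hWC
  omega

/-- **A column-arm coordinate vanishes** (transpose of `exists_rowArm_vanish_five`; R11 copy at five of ✓ `exists_colArm_vanish`). [folklore] -/
theorem exists_colArm_vanish_five [CharZero K] (W : Submodule K (Fin 4 × Fin 4 → K))
    (hX : ∀ x ∈ W, ∀ i j : Fin 4, i ≠ 3 → j ≠ 3 → x (i, j) = 0) (h5 : finrank K W = 5)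
    (hW : ∀ y ∈ W, ∃ (c : Fin 5 → K) (Λ : Fin 5 → ((Fin 4 × Fin 4 → K) →ₗ[K] K)),
      ∀ u : Fin 4 × Fin 4 → K, ∃ e₀ e₁ : K, ∀ s : K,
        eval (u + s • y) (perPoly (Fin 4) K) = e₀ + s * e₁ + s ^ 2 * ∑ k, c k * (Λ k u) ^ 2) :
    ∃ b : Fin 4, b ≠ 3 ∧ ∀ y ∈ W, y (b, 3) = 0 := by
  set W' := W.map (transposeL (K := K) : (Fin 4 × Fin 4 → K) →ₗ[K] (Fin 4 × Fin 4 → K)) with hW'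
  have hmem : ∀ y ∈ W, transposeL (K := K) y ∈ W' := fun y hy => Submodule.mem_map_of_mem hy
  have hX' : ∀ x ∈ W', ∀ i j : Fin 4, i ≠ 3 → j ≠ 3 → x (i, j) = 0 := by
    rintro _ ⟨x, hx, rfl⟩ i j hi hj
    change transposeL (K := K) x (i, j) = 0
    rw [transposeL_apply]
    exact hX x hx j i hj hi
  have h5' : finrank K W' = 5 := by rw [hW', LinearEquiv.finrank_map_eq, h5]
  have hWf' := SymPencilPerFourLowRankSeven.sqFamilySwap_map W (transposeL (K := K))
    (fun z => SymPencilPerFourTwoRowsRadical.eval_perPoly_transpose z) hW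
  obtain ⟨a, ha3, ha⟩ := exists_rowArm_vanish_five W' hX' h5' hWf'
  refine ⟨a, ha3, fun y hy => ?_⟩
  have h := ha _ (hmem y hy)
  rwa [transposeL_apply] at h

/-- **Leaf X at the cross `X₃₃`, five squares**: a `5`-dimensional `W ⊆ X₃₃` with `PerDirFive` is
`X₃₃ ∩ {x_(3,a) = 0} ∩ {x_(b,3) = 0}` (`a, b ≠ 3`) (R11 copy at five of ✓ `crossFive33`). [folklore] -/
theorem crossFive33_five [CharZero K] (W : Submodule K (Fin 4 × Fin 4 → K))
    (hX : ∀ x ∈ W, ∀ i j : Fin 4, i ≠ 3 → j ≠ 3 → x (i, j) = 0) (h5 : finrank K W = 5)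
    (hW : ∀ y ∈ W, ∃ (c : Fin 5 → K) (Λ : Fin 5 → ((Fin 4 × Fin 4 → K) →ₗ[K] K)),
      ∀ u : Fin 4 × Fin 4 → K, ∃ e₀ e₁ : K, ∀ s : K,
        eval (u + s • y) (perPoly (Fin 4) K) = e₀ + s * e₁ + s ^ 2 * ∑ k, c k * (Λ k u) ^ 2) :
    ∃ a b : Fin 4, a ≠ 3 ∧ b ≠ 3 ∧ ∀ x : Fin 4 × Fin 4 → K, x ∈ W ↔
      ((∀ i j : Fin 4, i ≠ 3 → j ≠ 3 → x (i, j) = 0) ∧ x (3, a) = 0 ∧ x (b, 3) = 0) := by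
  classical
  obtain ⟨a, ha3, haW⟩ := exists_rowArm_vanish_five W hX h5 hW
  obtain ⟨b, hb3, hbW⟩ := exists_colArm_vanish_five W hX h5 hW
  set T : Finset (Fin 4 × Fin 4) := Finset.univ.filter fun p : Fin 4 × Fin 4 =>
    (p.1 = 3 ∨ p.2 = 3) ∧ p ≠ (3, a) ∧ p ≠ (b, 3) with hT
  have hcard : T.card = 5 := by
    have key : ∀ a b : Fin 4, a ≠ 3 → b ≠ 3 → (Finset.univ.filter fun p : Fin 4 × Fin 4 =>
        (p.1 = 3 ∨ p.2 = 3) ∧ p ≠ (3, a) ∧ p ≠ (b, 3)).card = 5 := by decide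
    exact key a b ha3 hb3
  obtain ⟨C, hC, hCmem⟩ := exists_span_of_support (K := K) T
  have hsuppT : ∀ z : Fin 4 × Fin 4 → K, (∀ i j : Fin 4, i ≠ 3 → j ≠ 3 → z (i, j) = 0) →
      z (3, a) = 0 → z (b, 3) = 0 → ∀ p, p ∉ T → z p = 0 := by
    intro z hz hza hzb p hp
    by_cases hpa : p = (3, a)
    · rw [hpa]; exact hza
    by_cases hpb : p = (b, 3)
    · rw [hpb]; exact hzb
    have hnc : ¬ (p.1 = 3 ∨ p.2 = 3) := fun hc =>
      hp (Finset.mem_filter.2 ⟨Finset.mem_univ _, hc, hpa, hpb⟩)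
    push Not at hnc
    have h := hz p.1 p.2 hnc.1 hnc.2
    rwa [Prod.mk.eta] at h
  have hWC : W ≤ C := fun y hy => hCmem y (hsuppT y (hX y hy) (haW y hy) (hbW y hy))
  have hWeq : W = C :=
    Submodule.eq_of_le_of_finrank_le hWC (hC.trans (by rw [hcard, h5]))
  refine ⟨a, b, ha3, hb3, fun x => ⟨fun hx => ⟨hX x hx, haW x hx, hbW x hx⟩, fun hx => ?_⟩⟩
  rw [hWeq]
  exact hCmem x (hsuppT x hx.1 hx.2.1 hx.2.2)

/-- **Leaf X at a general cross `X_{lc}`, five squares** (transport by the swaps `3 ↔ l`, `3 ↔ c`, as in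
`SymPencilPerFourCrossFilter.crossFilter`; R11 copy at five of ✓ `crossFive`). [folklore] -/
theorem crossFive_five [CharZero K] (W : Submodule K (Fin 4 × Fin 4 → K)) {l c : Fin 4}
    (hX : ∀ x ∈ W, ∀ i j : Fin 4, i ≠ l → j ≠ c → x (i, j) = 0) (h5 : finrank K W = 5)
    (hW : ∀ y ∈ W, ∃ (c : Fin 5 → K) (Λ : Fin 5 → ((Fin 4 × Fin 4 → K) →ₗ[K] K)),
      ∀ u : Fin 4 × Fin 4 → K, ∃ e₀ e₁ : K, ∀ s : K,
        eval (u + s • y) (perPoly (Fin 4) K) = e₀ + s * e₁ + s ^ 2 * ∑ k, c k * (Λ k u) ^ 2) :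
    ∃ a b : Fin 4, a ≠ c ∧ b ≠ l ∧ ∀ x : Fin 4 × Fin 4 → K, x ∈ W ↔
      ((∀ i j : Fin 4, i ≠ l → j ≠ c → x (i, j) = 0) ∧ x (l, a) = 0 ∧ x (b, c) = 0) := by
  set σ : Equiv.Perm (Fin 4) := Equiv.swap 3 l with hσ
  set τ : Equiv.Perm (Fin 4) := Equiv.swap 3 c with hτ
  set Φ : (Fin 4 × Fin 4 → K) ≃ₗ[K] (Fin 4 × Fin 4 → K) :=
    LinearEquiv.funCongrLeft K K (Equiv.prodCongr σ τ) with hΦ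
  have hΦa : ∀ (x : Fin 4 × Fin 4 → K) (i j : Fin 4), Φ x (i, j) = x (σ i, τ j) := fun x i j => rfl
  have hσ3 : σ 3 = l := by rw [hσ, Equiv.swap_apply_left]
  have hτ3 : τ 3 = c := by rw [hτ, Equiv.swap_apply_left]
  have hW' := SymPencilPerFourLowRankSeven.sqFamilySwap_map W Φ
    (fun z => SymPencilPerFourBlocks.eval_perPoly_comp_prodCongr σ τ z) hW
  set W' := W.map Φ.toLinearMap with hW'def
  have hfin : finrank K W' = 5 := by rw [hW'def, LinearEquiv.finrank_map_eq, h5]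
  have hsupp : ∀ x : Fin 4 × Fin 4 → K, (∀ i j : Fin 4, i ≠ l → j ≠ c → x (i, j) = 0) ↔
      (∀ i j : Fin 4, i ≠ 3 → j ≠ 3 → Φ x (i, j) = 0) := by
    intro x
    constructor
    · intro h i j hi hj
      rw [hΦa]
      refine h (σ i) (τ j) (fun h' => hi ?_) (fun h' => hj ?_)
      · exact σ.injective (h'.trans hσ3.symm)
      · exact τ.injective (h'.trans hτ3.symm)
    · intro h i j hi hj
      have h' := h (σ.symm i) (τ.symm j) (fun h'' => hi ?_) (fun h'' => hj ?_)
      · rwa [hΦa, Equiv.apply_symm_apply, Equiv.apply_symm_apply] at h'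
      · rw [← hσ3, ← h'', Equiv.apply_symm_apply]
      · rw [← hτ3, ← h'', Equiv.apply_symm_apply]
  have hX' : ∀ x ∈ W', ∀ i j : Fin 4, i ≠ 3 → j ≠ 3 → x (i, j) = 0 := by
    rintro _ ⟨x, hx, rfl⟩
    exact (hsupp x).1 (hX x hx)
  obtain ⟨a', b', ha', hb', hmem'⟩ := crossFive33_five W' hX' hfin hW'
  have hmemW : ∀ x : Fin 4 × Fin 4 → K, x ∈ W ↔ Φ x ∈ W' := fun x => by
    rw [hW'def, Submodule.mem_map_equiv, LinearEquiv.symm_apply_apply]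
  refine ⟨τ a', σ b', ?_, ?_, fun x => ?_⟩
  · intro h
    exact ha' (τ.injective (h.trans hτ3.symm))
  · intro h
    exact hb' (σ.injective (h.trans hσ3.symm))
  · rw [hmemW x, hmem' (Φ x), ← hsupp x, hΦa, hΦa, hσ3, hτ3]

end Summit.ValiantsHypothesis.ValiantsHypothesis.Theorems.SymPencilSingFiveClassification

end
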